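import Summits.BirchSwinnertonDyer.BirchSwinnertonDyer.Theorems.ByReductionTypeAtTwoRankOneAtTwoOffBigImageOddLocalArchFrickeHalfSum
import HarnessLib

/-!
# Route `ByReductionTypeAtTwo`, crux `RankOneAtTwoOffBigImageOddLocal` (stmt-BirchSwinnertonDyer-23716), line
# `refined_kolyvagin_tamagawa_shift_at_two`, stub `stub_sigmaShiftPosDisc`: THE ODD TWISTED SUM OF MINUS SYMBOLS MOD 2 — the boundary-level
# archimedean bit of the principal oval equals the parity of `Σ_a χ(a)[a/ℓ]⁻_f` for every odd `±1`-valued `χ` (PROVED, tree currency)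

Lead prover `prover-cruxlead-stmt-BirchSwinnertonDyer-23716-g12` (2026-08-29), `--supports stmt-BirchSwinnertonDyer-23716` (helper; closes
nothing).  THEOREMS ONLY.  Sequel to `…ArchFrickeHalfSum.lean` (p700217); memo `Cruxes/RankOneAtTwoOffBigImageOddLocal/ArchBoundaryBitAtTwo.md` §8.3.

WHY.  `…ArchFrickeHalfSum.halfSum_normalizedMinusSymbol_congr` says: for real-coefficient `f ∈ S₂(Γ₀(N))` with Fricke eigenvalue `+1` and an odd
prime `ℓ ∤ N`, `Σ_{1 ≤ k ≤ (ℓ−1)/2} [k/ℓ]⁻_f ≡ Σ_{N k² = 1, k ≤ (ℓ−1)/2} [k/ℓ]⁻_f (mod ℤ)` (all `[k/ℓ]⁻_f ∈ ½ℤ`).  This file turns the half-sum into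
the TWISTED sum of Birch's formula: for every odd function `χ : ZMod ℓ → ℤ` with `χ(a) = ±1` for `a ≠ 0` (the Legendre symbol when `ℓ ≡ 3 (mod 4)`,
any odd `±1`-valued choice in general),
  `Σ_{a mod ℓ} χ(a)·[a/ℓ]⁻_f = 2·Σ_{N k² = 1, 1 ≤ k ≤ (ℓ−1)/2} [k/ℓ]⁻_f + 2ℤ`   (`twistedMinusSum_congr`),
i.e. the integer `Σ_a χ(a)[a/ℓ]⁻_f` is EVEN unless `N` is a square mod `ℓ`, and then has the parity of `y(s/ℓ) = 2[s/ℓ]⁻_f`, `N s² ≡ 1 (mod ℓ)` — the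
boundary-level archimedean bit of the principal oval's `T_ℓ`-children (memo §8.1–§8.3).  With the tree's signed Birch formula
(`Literature…ratMinusTwistedSymbolSum_jacobiChar_mul_minusPeriod`: `(Σ_a (a/ℓ)[a/ℓ]⁻_f)·Ω⁻_f = √ℓ·L(f, χ_ℓ, 1)` for `ℓ ≡ 3 (mod 4)`) this is the
statement of memo §8.3: **the bit is the parity of `√ℓ·L(E^{(−ℓ)},1)/Ω⁻`, i.e. of `L(E^{(−ℓ)},1)/Ω_BSD(E^{(−ℓ)})`** — the principal case of conjecture
MS-even («a_ℓ even ⇒ bit = 0») is the BSD₂ Tamagawa parity `c_ℓ(E^{(−ℓ)}) ∈ {2,4}` of the rank-0 twist (Birch's formula itself is not invoked here).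

* §1 `sum_univ_eq_of_even` — for an even `φ` on `ZMod ℓ` (`ℓ` odd prime): `Σ_a φ a = φ 0 + 2·Σ_{1 ≤ a.val ≤ (ℓ−1)/2} φ a`.
* §2 `normalizedMinusSymbol_neg_val` (oddness of `[·]⁻` in the numerator class), `twistedMinusSum_congr`.

BSD is NOT proved by any of this; the crux is NOT proved; the stub is NOT proved; MS-even / A∞′ are NOT proved.

References: [MazurTateTeitelbaum1986Invent] §I.8 (8.6) (Birch's formula), §I.17 (Fricke symmetry); [Cremona1997] §2.8.
-/

set_option linter.dupNamespace false -- tree convention: `Summit.BirchSwinnertonDyer.BirchSwinnertonDyer.Theorems` (summit = sub-problem)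
set_option autoImplicit false

noncomputable section

open scoped MatrixGroups ModularForm

open CongruenceSubgroup Complex Finset
open Literature.NumberTheory.EllipticCurves.ModularForms
open Summit.BirchSwinnertonDyer.BirchSwinnertonDyer.Theorems.OffBigImageOddLocalAtTwo.ArchFrickeHalfSum

namespace Summit.BirchSwinnertonDyer.BirchSwinnertonDyer.Theorems.OffBigImageOddLocalAtTwo.ArchFrickeTwistSum

/-! ## §1 Even functions on `ZMod ℓ`: the sum over all residues is the value at `0` plus twice the half-sum -/

section Even

variable {ℓ : ℕ} [Fact ℓ.Prime] {B : Type*} [AddCommGroup B]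

/-- **`Σ_a φ a = φ 0 + 2·Σ_{1 ≤ a.val ≤ (ℓ−1)/2} φ a`** for an even function `φ` on `ZMod ℓ`, `ℓ` an odd prime: the residues split as
`{0} ⊔ H ⊔ (−H)`, `H = {1 ≤ val ≤ (ℓ−1)/2}`, and `a ↦ −a` maps `H` onto `{(ℓ+1)/2 ≤ val ≤ ℓ−1}`. [folklore] -/
theorem sum_univ_eq_of_even (hℓ2 : ℓ ≠ 2) (φ : ZMod ℓ → B) (hφ : ∀ a, φ (-a) = φ a) :
    ∑ a : ZMod ℓ, φ a = φ 0 + 2 • ∑ a ∈ (univ : Finset (ZMod ℓ)).filter (fun a ↦ 1 ≤ a.val ∧ a.val ≤ (ℓ - 1) / 2), φ a := by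
  classical
  have hℓp : ℓ.Prime := Fact.out
  haveI : NeZero ℓ := ⟨hℓp.ne_zero⟩
  obtain ⟨m, hm⟩ : ∃ m, ℓ = 2 * m + 1 := hℓp.odd_of_ne_two hℓ2
  have hm2 : (ℓ - 1) / 2 = m := by omega
  rw [hm2]
  set H : Finset (ZMod ℓ) := (univ : Finset (ZMod ℓ)).filter (fun a ↦ 1 ≤ a.val ∧ a.val ≤ m) with hH
  set H' : Finset (ZMod ℓ) := (univ : Finset (ZMod ℓ)).filter (fun a ↦ m + 1 ≤ a.val) with hH'
  -- split `univ` as `{0} ∪ H ∪ H'` via the value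
  have hsplit : ∑ a : ZMod ℓ, φ a = φ 0 + ∑ a ∈ H, φ a + ∑ a ∈ H', φ a := by
    rw [← sum_filter_add_sum_filter_not univ (fun a : ZMod ℓ ↦ a.val = 0)]
    have h0 : (univ : Finset (ZMod ℓ)).filter (fun a ↦ a.val = 0) = {0} := by
      ext a
      simp only [mem_filter, mem_univ, true_and, mem_singleton, ZMod.val_eq_zero]
    rw [h0, sum_singleton]
    rw [← sum_filter_add_sum_filter_not ((univ : Finset (ZMod ℓ)).filter (fun a ↦ ¬ a.val = 0)) (fun a ↦ a.val ≤ m),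
      filter_filter, filter_filter]
    have h1 : (univ : Finset (ZMod ℓ)).filter (fun a ↦ ¬ a.val = 0 ∧ a.val ≤ m) = H := by
      rw [hH]; ext a; simp only [mem_filter, mem_univ, true_and]; omega
    have h2 : (univ : Finset (ZMod ℓ)).filter (fun a ↦ ¬ a.val = 0 ∧ ¬ a.val ≤ m) = H' := by
      rw [hH']; ext a; simp only [mem_filter, mem_univ, true_and]; omega
    rw [h1, h2, add_assoc]
  -- `a ↦ −a` maps `H` bijectively onto `H'` and `φ` is even
  have hneg : ∑ a ∈ H', φ a = ∑ a ∈ H, φ a := by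
    refine (sum_nbij' (fun a ↦ -a) (fun a ↦ -a) ?_ ?_ (fun a _ ↦ neg_neg a) (fun a _ ↦ neg_neg a) ?_).symm
    · intro a ha
      rw [hH, mem_filter] at ha
      rw [hH', mem_filter]
      have ha0 : a ≠ 0 := fun h ↦ by rw [h, ZMod.val_zero] at ha; omega
      have := ZMod.val_lt a
      refine ⟨mem_univ _, ?_⟩
      rw [ZMod.neg_val, if_neg ha0]
      omega
    · intro a ha
      rw [hH', mem_filter] at ha
      rw [hH, mem_filter]
      have ha0 : a ≠ 0 := fun h ↦ by rw [h, ZMod.val_zero] at ha; omega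
      have := ZMod.val_lt a
      refine ⟨mem_univ _, ?_, ?_⟩
      · rw [ZMod.neg_val, if_neg ha0]; omega
      · rw [ZMod.neg_val, if_neg ha0]; omega
    · intro a _
      exact (hφ a).symm
  rw [hsplit, hneg, add_assoc, two_nsmul]

end Even

/-! ## §2 The odd twisted sum of minus symbols -/

section Twist

variable {N : ℕ} [NeZero N] {f : CuspForm (Gamma0 N) 2} {ℓ : ℕ} [Fact ℓ.Prime]

/-- `[(−a).val/ℓ]⁻_f = −[a.val/ℓ]⁻_f` for `a ≠ 0` (numerator periodicity + oddness, from `ArchFrickeHalfSum.minusSymbol_neg_val`).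
[cite: MazurTateTeitelbaum1986Invent, §I.17] -/
theorem normalizedMinusSymbol_neg_val {ε : ℂ} (hW : IsFrickeEigen N f ε) (hε : ε ^ 2 = 1) (hN : (N : ZMod ℓ) ≠ 0) {a : ZMod ℓ}
    (ha : a ≠ 0) : normalizedMinusSymbol f (((-a).val : ℚ) / ℓ) = -normalizedMinusSymbol f ((a.val : ℚ) / ℓ) := by
  rw [normalizedMinusSymbol, normalizedMinusSymbol, minusSymbol_neg_val hW hε hN ha, Complex.neg_im, neg_div]

/-- **THE ODD TWISTED SUM MOD 2.**  `f ∈ S₂(Γ₀(N))` real-coefficient with pointwise Fricke eigenvalue `+1`, `ℓ ∤ N` an odd prime, `χ : ZMod ℓ → ℤ`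
odd with `χ(a) = ±1` for `a ≠ 0`.  Then `Σ_{a mod ℓ} χ(a)·[a/ℓ]⁻_f = 2·Σ_{1 ≤ k ≤ (ℓ−1)/2, N k² = 1} [k/ℓ]⁻_f + 2z` with `z ∈ ℤ`.
(Pair `a ↔ −a`: both factors change sign, so the sum is twice the half-sum `Σ_H χ(a)[a/ℓ]⁻`; `χ(a) − 1 ∈ {0, −2}` and `2[a/ℓ]⁻ ∈ ℤ` turn it into
`2·Σ_H [a/ℓ]⁻ (mod 2ℤ)`; `halfSum_normalizedMinusSymbol_congr` finishes.)  For `ℓ ≡ 3 (mod 4)` and `χ = (·/ℓ)` the left side times `Ω⁻_f` is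
`√ℓ·L(f, χ_ℓ, 1)` by the tree's signed Birch formula; so the parity of the algebraic twisted `L`-value is the minus-symbol bit `y(s/ℓ) mod 2`
(`= 0` when `(N/ℓ) = −1`). [cite: MazurTateTeitelbaum1986Invent, §I.8 (8.6) and §I.17] [cite: Cremona1997, §2.8] -/
theorem twistedMinusSum_congr (hW : IsFrickeEigen N f 1) (hreal : ∀ n, (cuspCoeff f n).im = 0) (hN : (N : ZMod ℓ) ≠ 0) (hℓ2 : ℓ ≠ 2)
    (χ : ZMod ℓ → ℤ) (hodd : ∀ a, χ (-a) = -χ a) (hunit : ∀ a, a ≠ 0 → χ a = 1 ∨ χ a = -1) :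
    ∃ z : ℤ, ∑ a : ZMod ℓ, (χ a : ℝ) * normalizedMinusSymbol f ((a.val : ℚ) / ℓ) =
      2 * (∑ k ∈ ((univ : Finset (ZMod ℓ)).filter (fun k ↦ 1 ≤ k.val ∧ k.val ≤ (ℓ - 1) / 2)).filter
          (fun k ↦ (N : ZMod ℓ) * k * k = 1), normalizedMinusSymbol f ((k.val : ℚ) / ℓ)) + 2 * z := by
  classical
  have h11 : (1 : ℂ) ^ 2 = 1 := one_pow 2
  set H : Finset (ZMod ℓ) := (univ : Finset (ZMod ℓ)).filter (fun k ↦ 1 ≤ k.val ∧ k.val ≤ (ℓ - 1) / 2) with hH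
  -- χ(0) = 0
  have hχ0 : χ 0 = 0 := by have h := hodd 0; rw [neg_zero] at h; omega
  -- the summand is even
  have heven : ∀ a : ZMod ℓ, (χ (-a) : ℝ) * normalizedMinusSymbol f (((-a).val : ℚ) / ℓ) =
      (χ a : ℝ) * normalizedMinusSymbol f ((a.val : ℚ) / ℓ) := by
    intro a
    by_cases ha : a = 0
    · rw [ha, neg_zero]
    · rw [hodd, normalizedMinusSymbol_neg_val hW h11 hN ha]; push_cast; ring
  rw [sum_univ_eq_of_even hℓ2 _ heven, hχ0, ZMod.val_zero]
  push_cast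
  rw [zero_mul, zero_add]
  -- the half-sum: χ(a)[a]⁻ = [a]⁻ + (χ a − 1)[a]⁻ with (χ a − 1) ∈ {0,−2} and 2[a]⁻ ∈ ℤ
  have hterm : ∀ a ∈ H, ∃ w : ℤ, (χ a : ℝ) * normalizedMinusSymbol f ((a.val : ℚ) / ℓ) =
      normalizedMinusSymbol f ((a.val : ℚ) / ℓ) + (w : ℝ) := by
    intro a ha
    have ha0 : a ≠ 0 := by
      intro h; rw [hH, mem_filter, h, ZMod.val_zero] at ha; omega
    obtain ⟨k, hk⟩ := exists_normalizedMinusSymbol_val_eq_div_two hreal hN a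
    rcases hunit a ha0 with h1 | h1
    · exact ⟨0, by rw [h1]; push_cast; ring⟩
    · exact ⟨-k, by rw [h1, hk]; push_cast; ring⟩
  choose! w hw using hterm
  have hsum : ∑ a ∈ H, (χ a : ℝ) * normalizedMinusSymbol f ((a.val : ℚ) / ℓ) =
      ∑ a ∈ H, normalizedMinusSymbol f ((a.val : ℚ) / ℓ) + ((∑ a ∈ H, w a : ℤ) : ℝ) := by
    rw [Int.cast_sum, ← sum_add_distrib]
    exact sum_congr rfl hw
  obtain ⟨z₀, hz₀⟩ := halfSum_normalizedMinusSymbol_congr hW hreal hN hℓ2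
  refine ⟨z₀ + ∑ a ∈ H, w a, ?_⟩
  rw [two_nsmul, ← two_mul, hsum]
  have hz₀' : ∑ k ∈ H, normalizedMinusSymbol f ((k.val : ℚ) / ℓ) =
      ∑ k ∈ H.filter (fun k ↦ (N : ZMod ℓ) * k * k = 1), normalizedMinusSymbol f ((k.val : ℚ) / ℓ) + z₀ := by
    linear_combination hz₀
  rw [hz₀']
  push_cast
  ring

end Twist

end Summit.BirchSwinnertonDyer.BirchSwinnertonDyer.Theorems.OffBigImageOddLocalAtTwo.ArchFrickeTwistSum

end
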